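import Literature.Analysis.FluidPDE.ClassicalSolution
import Literature.Analysis.FunctionSpaces.HolderNorm
import HarnessLib

/-!
# Córdoba–Martínez-Zoroa: finite-time blow-up for the FORCED incompressible 3D Euler equations
# on `ℝ³` with a force uniformly in `C^{1,1/2−ε} ∩ L²` and velocity in `C^{3,1/2} ∩ L²`

Topic `Literature/Analysis/FluidPDE`. Statements file (ONE NAMED FACT with cite tag, over accepted
vocabulary only; the elementary consequences are proved). Source: `[CordobaMartinezZoroa2023]`
D. Córdoba, L. Martínez-Zoroa, *Blow-up for the incompressible 3D-Euler equations with uniform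
`C^{1,1/2−ε} ∩ L²` force*, arXiv:2309.08495 (2023) ("p." = 3000-character chunk of the held text
`paper:arxiv-2309.08495`).

WHAT THIS IS (and is not). A finite-time singularity of FORCED, INVISCID (Euler) flow on `ℝ³`:
non-axisymmetric, not built in self-similar coordinates (a cascade of vortex layers near a
hyperbolic saddle, each switched on by the force and stretched by its parent, §1.2 p. 4–5), with
velocity slices in `C^{3,1/2} ∩ L²` — smoother than the `C^{1,1/3+}` threshold of the swirl-free
axisymmetric constructions (Elgindi; Elgindi–Ghoul–Masmoudi; Córdoba–Martínez-Zoroa–Zheng 2023,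
tree `CordobaMartinezZoroaZheng2023.holderEulerBlowup`) — but driven by a force that is only
uniformly `C^{1,1/2−ε} ∩ L²` (not smooth, not decaying: not a Clay-class force). The viscous
companion with fractional dissipation `ν|∇|^α`, `α < 0.0928`, and a rougher force
`L¹_t C^{1,ε}_x` is the tree's `CordobaMartinezZoroaZheng2024.hypodissipativeForcedBlowup`
(`HypodissipativeNSForcedBlowup.lean`). Nothing here is a statement about the Navier–Stokes
equations.

## The printed statement (§1.1, p. 4)

Equation (Euler), §1 p. 3: "`∂ₜu + (u·∇)u + ∇p = f`, `∇·u = 0`, `u₀(x) = u(x,0)`" on `ℝ³`, `f` "an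
external force". **Theorem 1.1** (p. 4, L13–14): "For any `ε > 0`, there exist solutions of the
forced 3D incompressible Euler equations (Euler) in `ℝ³ × [0,T]` with a finite `T > 0` and with an
external forcing which is uniformly in `C^{1,1/2−ε} ∩ L²`, such that on the time interval
`0 ≤ t < T`, the velocity `u` is in the space `C^{3,1/2} ∩ L²` and satisfies
`lim_{t→T} ∫₀ᵗ |∇u(x,s)|_{L^∞} ds = ∞`." Remark 1: "Even though this is not proved in this paper,
a careful study of the solution shows that, for any `δ > 0`, the solution for `t ∈ [0,T−δ]`
fulfills `u ∈ C^∞`, and similarly the forcing `f ∈ C^∞`. Furthermore the vorticity is compactly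
supported for all `t ∈ [0,T]`." Remark 2: "The solution at time `T` is in `C^{1−δ}`, where `δ`
depends on `ε`." Remark 3: "A more careful construction would allow us to show the result with
forcing `f` uniformly bounded in `C^{1,α}` for all `α ∈ [0,1/2)`." The solution notion (§2.3,
Definition 1, p. 6): the vorticity `ω` and the vorticity forcing `F = ∇ × f` compactly supported,
divergence free with zero average, `∂ₜω + u·∇ω = ω·∇u + F`, `u` recovered by the Biot–Savart
law (then `F ∈ C^α ⇒ f ∈ C^{1,α}`, Remark 5 p. 6); §5 p. 20: the construction is normalised to
`T = 1`, `ω^∞ = lim ωⁱ` is, locally on `[0,1)`, a finite sum of `C^{2.5}` vorticities with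
`u ∈ C^{3.5}`, the force bound `‖F^∞(·,t₀)‖_{C^{1/2−6ε}} ≤ C` is proved "for any fixed
`t₀ ∈ [0,1)`", and `|u(t_i)|_{C¹} ≥ (C₀/4) M_{i−1}^ε → ∞` along `t_i ↑ 1`.

## Rendering (WEAKER than print where the print is loose; no new notion)

* Hölder exponent: "for any `ε > 0` … `C^{1,1/2−ε}`" is rendered as "for every `0 < α < 1/2` the
  force is uniformly in `C^{1,α}`" (`α = 1/2 − ε`; for `ε ≥ 1/2` the printed class is void).
* The force: `sup_{0 ≤ t < T} ‖f(t)‖_{C^{1,α}(ℝ³)} < ∞` and `sup_{0 ≤ t < T} ∫|f(t)|² < ∞` with the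
  tree's total `C^{k,α}` norm `FunctionSpaces.eContDiffHolderNorm 1 α` (`HolderNorm.lean`) and
  `eEnergy` (`VectorCalculus.lean`) — on the half-open interval `[0,T)`, which is where the printed
  proof bounds it (§5 p. 20); nothing is recorded at the blow-up instant `t = T` itself.
* The velocity: every slice `u(t)`, `0 ≤ t < T`, in `C^{3,1/2}_b(ℝ³)`
  (`FunctionSpaces.MemContDiffHolder 3 (1/2)`) and in `L²` (`eEnergy (u t) < ⊤`).
* The equations: classically at every `(t,x) ∈ [0,T) × ℝ³` — `s ↦ u(s,x)` has the one-sided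
  derivative `f − (u·∇)u − ∇p` within `[0,T)` at `t` (Mathlib `HasDerivWithinAt`, the convention
  of the tree's `timeDerivWithin`/`IsClassicalNSSolutionOn` and of
  `CordobaMartinezZoroaZheng2023.gDGHolderBlowup`), `div u(t) = 0` (`VectorCalculus.IsDivFree`),
  the pressure slice `C¹` so that `∇p` is meaningful (the source prints nothing more about `p`).
  Joint smoothness on `[0,T−δ] × ℝ³` (Remark 1, "not proved in this paper"), the regularity at
  `t = T` (Remark 2), the stronger force classes of Remark 3, compact support of the vorticity and
  the non-axisymmetry of the construction are NOT rendered.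
* Loss of regularity: `∫_{(0,t)} ‖∇u(s)‖_{L^∞} ds → ∞` as `t ↑ T`, verbatim the clause of
  `CordobaMartinezZoroaZheng2024.hypodissipativeForcedBlowup` (`‖∇u(s)‖_{L^∞}` = the tree's
  `FunctionSpaces.eSupNorm` of the Fréchet derivative `x ↦ Du(s)(x)`).
* Proved: the momentum equation in the tree's `timeDerivWithin` shape (`momentum_eq`); the
  divergence of the integral forbids a uniform Lipschitz bound on `[0,T)`
  (`not_forall_eSupNorm_fderiv_le_of_tendsto`, `gradient_unbounded`); and the projection used by
  consumers, a forced Euler blow-up from `C³` data with a force bounded in some `C^{1,α} ∩ L²`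
  (`exists_blowup_quarter`, `α = 1/4`).

## Consumers (by name, not restated there)

`Literature.Barriers.AnomalousDissipation.ClassicalEulerLimit` (evasions (2) / scope (a),(e) of both
barrier blocks cite this theorem in prose: loss of Lipschitz regularity of forced Euler with a
`ν`-independent force above the Lipschitz threshold, on `ℝ³`; periodic analogue not in print); the
`nearmiss` lens deficit table row A2 (force regularity `C^{1,1/2−}` vs the Clay class) on
`stmt-NavierStokesRegularity-19179`.
-/

noncomputable section

open MeasureTheory Set Function Filter
open _root_.Topology
open scoped NNReal ENNReal ContDiff

namespace Literature.Analysis.FluidPDE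

namespace CordobaMartinezZoroa2023

/-- **Córdoba–Martínez-Zoroa, Theorem 1.1 (arXiv:2309.08495, §1.1 p. 4)**: "For any `ε > 0`, there
exist solutions of the forced 3D incompressible Euler equations in `ℝ³ × [0,T]` with a finite
`T > 0` and with an external forcing which is uniformly in `C^{1,1/2−ε} ∩ L²`, such that on the time
interval `0 ≤ t < T`, the velocity `u` is in the space `C^{3,1/2} ∩ L²` and satisfies
`lim_{t→T} ∫₀ᵗ |∇u(x,s)|_{L^∞} ds = ∞`." **Rendering** (module docstring; `α = 1/2 − ε`): for every
`0 < α < 1/2` there are `T > 0`, a force `f`, a velocity `u` and a pressure `p` on `[0,T) × ℝ³` with: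
at every `0 ≤ t < T` and every `x`, `s ↦ u(s,x)` has one-sided derivative
`f(t,x) − (u·∇)u(t,x) − ∇p(t,x)` within `[0,T)` at `t`; `div u(t) = 0`; `p(t) ∈ C¹`; the slices
`u(t) ∈ C^{3,1/2}_b(ℝ³)` with `∫|u(t)|² < ∞`; the force bounded on `[0,T)` in `C^{1,α}(ℝ³)` and in
`L²`: `‖f(t)‖_{C^{1,α}} ≤ C`, `∫|f(t)|² ≤ C`; and `∫_{(0,t)} ‖∇u(s)‖_{L^∞} ds → ∞` as `t ↑ T`.
Not rendered: Remarks 1–3 (smoothness on `[0,T−δ]`, compactly supported vorticity, `u(T) ∈ C^{1−δ}`,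
force in `C^{1,α}` for all `α < 1/2` at once — printed without proof), anything at `t = T`.
[cite: CordobaMartinezZoroa2023, Thm 1.1 (§1.1, p. 4 of arXiv:2309.08495); §2.3 Def. 1 and Remark 5 (p. 6); §5 proof of Thm 1.1 (p. 20)] -/
def forcedEulerHolderForceBlowup : Prop :=
  ∀ α : ℝ≥0, 0 < α → α < 1 / 2 →
    ∃ (T : ℝ) (f u : ℝ → EuclideanSpace ℝ (Fin 3) → EuclideanSpace ℝ (Fin 3))
      (p : ℝ → EuclideanSpace ℝ (Fin 3) → ℝ), 0 < T ∧
      -- the forced Euler equations, classically on `[0,T) × ℝ³` (one-sided time derivative)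
      (∀ t ∈ Ico 0 T, ∀ x,
        HasDerivWithinAt (fun s => u s x) (f t x - convect (u t) (u t) x - gradient (p t) x)
          (Ico 0 T) t) ∧
      (∀ t ∈ Ico 0 T, VectorCalculus.IsDivFree (u t)) ∧
      (∀ t ∈ Ico 0 T, ContDiff ℝ 1 (p t)) ∧
      -- the velocity on `[0,T)`: `C^{3,1/2} ∩ L²`
      (∀ t ∈ Ico 0 T, FunctionSpaces.MemContDiffHolder 3 (1 / 2) (u t) ∧ eEnergy (u t) < ⊤) ∧
      -- the force: uniformly in `C^{1,α} ∩ L²` on `[0,T)`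
      (∃ C : ℝ≥0, ∀ t ∈ Ico 0 T,
        FunctionSpaces.eContDiffHolderNorm 1 α (f t) ≤ C ∧ eEnergy (f t) ≤ C) ∧
      -- loss of regularity at `t = T`: `∫₀ᵗ ‖∇u(s)‖_{L^∞} ds → ∞`
      Tendsto (fun t : ℝ => ∫⁻ s in Ioo 0 t, FunctionSpaces.eSupNorm (fderiv ℝ (u s)))
        (𝓝[<] T) (𝓝 (⊤ : ℝ≥0∞))

/-! ### Elementary consequences (proved) -/

/-- The momentum equation of a solution as rendered above, in the shape of the tree's classical
solutions (`IsClassicalNSSolutionOn.momentum` with `ν = 0`): the one-sided time derivative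
`timeDerivWithin [0,T) u t x` satisfies `∂ₜu + (u·∇)u + ∇p = f` at every `(t,x) ∈ [0,T) × ℝ³`
(`[0,T)` has unique one-sided derivatives). [cite: CordobaMartinezZoroa2023, §1 eq. (Euler) (p. 3) and Thm 1.1 (p. 4)] -/
theorem momentum_eq {T : ℝ} {f u : ℝ → EuclideanSpace ℝ (Fin 3) → EuclideanSpace ℝ (Fin 3)}
    {p : ℝ → EuclideanSpace ℝ (Fin 3) → ℝ}
    (h : ∀ t ∈ Ico 0 T, ∀ x,
      HasDerivWithinAt (fun s => u s x) (f t x - convect (u t) (u t) x - gradient (p t) x)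
        (Ico 0 T) t)
    {t : ℝ} (ht : t ∈ Ico 0 T) (x : EuclideanSpace ℝ (Fin 3)) :
    timeDerivWithin (Ico 0 T) u t x + convect (u t) (u t) x + gradient (p t) x = f t x := by
  have hT : (0 : ℝ) < T := ht.1.trans_lt ht.2
  have hud : UniqueDiffWithinAt ℝ (Ico (0 : ℝ) T) t := uniqueDiffOn_Ico 0 T t ht
  rw [timeDerivWithin_apply, (h t ht x).derivWithin hud]
  abel

/-- If `∫_{(0,t)} g → ∞` as `t ↑ T` for a finite `T > 0`, then `g` is not bounded on `[0,T)` (the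
integral over `(0,t) ⊆ (0,T)` would stay below `C·T`). The mechanism by which Theorem 1.1's
conclusion forbids a uniform Lipschitz bound. [cite: CordobaMartinezZoroa2023, Thm 1.1 (p. 4)] -/
theorem not_forall_le_of_tendsto_lintegral {T : ℝ} (hT : 0 < T) {g : ℝ → ℝ≥0∞}
    (hg : Tendsto (fun t : ℝ => ∫⁻ s in Ioo 0 t, g s) (𝓝[<] T) (𝓝 (⊤ : ℝ≥0∞))) (C : ℝ≥0) :
    ¬ ∀ t ∈ Ico 0 T, g t ≤ C := by
  intro hC
  have hfin : (C : ℝ≥0∞) * ENNReal.ofReal T < ⊤ :=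
    ENNReal.mul_lt_top ENNReal.coe_lt_top ENNReal.ofReal_lt_top
  have hev : ∀ᶠ t in 𝓝[<] T, (C : ℝ≥0∞) * ENNReal.ofReal T < ∫⁻ s in Ioo 0 t, g s :=
    hg.eventually (lt_mem_nhds hfin)
  have hwin : ∀ᶠ t in 𝓝[<] T, t ∈ Ioo (0 : ℝ) T := Ioo_mem_nhdsLT hT
  obtain ⟨t, ht, htw⟩ := (hev.and hwin).exists
  have hle : ∫⁻ s in Ioo 0 t, g s ≤ (C : ℝ≥0∞) * volume (Ioo (0 : ℝ) t) :=
    (setLIntegral_mono' measurableSet_Ioo fun s hs => hC s ⟨hs.1.le, hs.2.trans htw.2⟩).trans_eq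
      (setLIntegral_const _ _)
  have hvol : volume (Ioo (0 : ℝ) t) ≤ ENNReal.ofReal T := by
    rw [Real.volume_Ioo, sub_zero]
    exact ENNReal.ofReal_le_ofReal htw.2.le
  have : (C : ℝ≥0∞) * volume (Ioo (0 : ℝ) t) ≤ (C : ℝ≥0∞) * ENNReal.ofReal T := by
    gcongr
  exact absurd (ht.trans_le (hle.trans this)) (lt_irrefl _)

/-- In particular the divergence of `∫₀ᵗ ‖∇u‖_{L^∞}` as `t ↑ T` forbids `sup_{t<T} ‖∇u(t)‖_{L^∞} < ∞`.
[cite: CordobaMartinezZoroa2023, Thm 1.1 (p. 4)] -/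
theorem not_forall_eSupNorm_fderiv_le_of_tendsto {T : ℝ} (hT : 0 < T)
    {u : ℝ → EuclideanSpace ℝ (Fin 3) → EuclideanSpace ℝ (Fin 3)}
    (hu : Tendsto (fun t : ℝ => ∫⁻ s in Ioo 0 t, FunctionSpaces.eSupNorm (fderiv ℝ (u s)))
      (𝓝[<] T) (𝓝 (⊤ : ℝ≥0∞))) (C : ℝ≥0) :
    ¬ ∀ t ∈ Ico 0 T, FunctionSpaces.eSupNorm (fderiv ℝ (u t)) ≤ C :=
  not_forall_le_of_tendsto_lintegral hT hu C

/-- From Theorem 1.1: for every `0 < α < 1/2`, a forced Euler flow on `[0,T) × ℝ³` whose force stays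
bounded in `C^{1,α}(ℝ³)` while the velocity gradient is NOT bounded on `[0,T) × ℝ³` — although
every slice `u(t)` is `C³`. (With a `C^{1,α}` force, local well-posedness in `C^{k,α} ∩ L²` holds —
Lichtenstein/Gunther, §1 p. 3 — so this is a genuine finite-time breakdown, not a rough-force
artefact.) [cite: CordobaMartinezZoroa2023, Thm 1.1 (p. 4) and §1 (p. 3)] -/
theorem forcedEulerHolderForceBlowup.gradient_unbounded (h : forcedEulerHolderForceBlowup)
    {α : ℝ≥0} (hα : 0 < α) (hα' : α < 1 / 2) :
    ∃ (T : ℝ) (f u : ℝ → EuclideanSpace ℝ (Fin 3) → EuclideanSpace ℝ (Fin 3))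
      (p : ℝ → EuclideanSpace ℝ (Fin 3) → ℝ), 0 < T ∧
      (∀ t ∈ Ico 0 T, ∀ x,
        timeDerivWithin (Ico 0 T) u t x + convect (u t) (u t) x + gradient (p t) x = f t x) ∧
      (∀ t ∈ Ico 0 T, VectorCalculus.IsDivFree (u t)) ∧
      (∀ t ∈ Ico 0 T, ContDiff ℝ 3 (u t)) ∧
      (∃ C : ℝ≥0, ∀ t ∈ Ico 0 T, FunctionSpaces.eContDiffHolderNorm 1 α (f t) ≤ C) ∧
      ∀ C : ℝ≥0, ¬ ∀ t ∈ Ico 0 T, FunctionSpaces.eSupNorm (fderiv ℝ (u t)) ≤ C := by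
  obtain ⟨T, f, u, p, hT, hmom, hdiv, -, hslice, ⟨C, hC⟩, hlim⟩ := h α hα hα'
  refine ⟨T, f, u, p, hT, fun t ht x => momentum_eq hmom ht x, hdiv,
    fun t ht => (hslice t ht).1.contDiff, ⟨C, fun t ht => (hC t ht).1⟩, ?_⟩
  exact not_forall_eSupNorm_fderiv_le_of_tendsto hT hlim

/-- Projection used by consumers (the `α`-free shape): there are `T > 0` and a classical forced
Euler flow on `[0,T) × ℝ³` with `C^{3,1/2} ∩ L²` slices whose force is bounded in
`C^{1,1/4}(ℝ³) ∩ L²` uniformly on `[0,T)` and whose Lipschitz norm is not integrable up to `T`: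
`∫_{(0,t)} ‖∇u‖_{L^∞} → ∞` (`t ↑ T`). Theorem 1.1 with `ε = 1/4`. [cite: CordobaMartinezZoroa2023, Thm 1.1 (p. 4)] -/
theorem forcedEulerHolderForceBlowup.exists_blowup_quarter (h : forcedEulerHolderForceBlowup) :
    ∃ (T : ℝ) (f u : ℝ → EuclideanSpace ℝ (Fin 3) → EuclideanSpace ℝ (Fin 3))
      (p : ℝ → EuclideanSpace ℝ (Fin 3) → ℝ), 0 < T ∧
      (∀ t ∈ Ico 0 T, ∀ x,
        timeDerivWithin (Ico 0 T) u t x + convect (u t) (u t) x + gradient (p t) x = f t x) ∧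
      (∀ t ∈ Ico 0 T, VectorCalculus.IsDivFree (u t)) ∧
      (∀ t ∈ Ico 0 T, FunctionSpaces.MemContDiffHolder 3 (1 / 2) (u t) ∧ eEnergy (u t) < ⊤) ∧
      (∃ C : ℝ≥0, ∀ t ∈ Ico 0 T,
        FunctionSpaces.eContDiffHolderNorm 1 (1 / 4) (f t) ≤ C ∧ eEnergy (f t) ≤ C) ∧
      Tendsto (fun t : ℝ => ∫⁻ s in Ioo 0 t, FunctionSpaces.eSupNorm (fderiv ℝ (u s)))
        (𝓝[<] T) (𝓝 (⊤ : ℝ≥0∞)) := by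
  have hq : (0 : ℝ≥0) < 1 / 4 := by norm_num
  have hq' : (1 / 4 : ℝ≥0) < 1 / 2 := by
    rw [← NNReal.coe_lt_coe]
    norm_num
  obtain ⟨T, f, u, p, hT, hmom, hdiv, -, hslice, hforce, hlim⟩ := h (1 / 4) hq hq'
  exact ⟨T, f, u, p, hT, fun t ht x => momentum_eq hmom ht x, hdiv, hslice, hforce, hlim⟩

end CordobaMartinezZoroa2023

end Literature.Analysis.FluidPDE
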